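import Literature.NumberTheory.Rogawski1990.TamagawaSingularMembersFinTFCovol               -- ★ p844690: (T′)'s covolume tokens (`cmDatum` adelic centralisers, the rational lattice)
import Literature.NumberTheory.Automorphic.UnitaryGroupCovolWeightStable                    -- ★ `countable_quotientSubgroup_inf_centralizer_subgroupOf` (the rational centraliser lattice is countable)
import Literature.NumberTheory.Automorphic.OrbitalMeasureQuotientOfPointHaarChange          -- ★ `quotientMeasure_nnreal_smul_haar`
import HarnessLib

/-!
# THE COVOLUME PULL-OUT in the tokens of the letter (T′): `covol(Z_c(L⁺)∖Z_c(𝔸); k • T) = k • covol(Z_c(L⁺)∖Z_c(𝔸); T)`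
(Rogawski (1990), §14.5 p. 239 «m(Z G′_{γ^δ}∖G′_{γ^δ})»; Deitmar–Echterhoff (2014), Thm. 1.5.3; Gelbart (1975), Remark 9.23)

Topic `NumberTheory/Rogawski1990`; namespace `Literature.NumberTheory.Rogawski1990`.  ONE THEOREM (no definition, no instance, no notation, no named fact, no `sorry`).  Cell
`pub/hodgecm-mathlib`, crux H413 (`stmt-HodgeConjecture-24833`), line LH5 (pay-down of the closer stub `stub_S1finTFCovol`), slice (γ2) of the SCALAR-TRANSPORT
`tprime_of_tprime_of_pinned` (owner LH5-p03 (g0)); LH5-plan (g0) DEAL 03:44:05Z to LH5-p01 (g0).  HONEST LABEL: HC_CM is proved only modulo the printed citations until rung 0 closes;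
this file is bookkeeping — scaling the Haar measure of the adelic centraliser `Z_c(𝔸)` by `k` scales the covolume of the (countable) rational lattice by `k`.

* `covol_nnreal_smul` — at a rational class `c`, for a Haar, right- and inversion-invariant `T` on `Z_c(𝔸)` and `k ≠ 0` in `ℝ≥0`, the covolume functional of (T′) (★ p844690 :246–:253,
  `quotientMeasure ((quotientSubgroup ⊓ Z_c).subgroupOf Z_c) count _ · Set.univ`) satisfies `covol(k • T) = k • covol(T)` (★ `quotientMeasure_nnreal_smul_haar`, the lattice being
  countable by ★ `countable_quotientSubgroup_inf_centralizer_subgroupOf`, so `count` is s-finite — the §3 pattern of ★ J2 `tamagawaSingularMembersFinTF_of_finTFCovol`).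

## References
* [Rogawski1990] J. D. Rogawski, *Automorphic Representations of Unitary Groups in Three Variables*, Ann. of Math. Stud. 123 (1990), §14.5 p. 239; §1.7 p. 6.
* [DeitmarEchterhoff2014] A. Deitmar, S. Echterhoff, *Principles of Harmonic Analysis*, 2nd ed. (2014), Thm. 1.5.3.
* [Gelbart1975] S. Gelbart, *Automorphic forms on adele groups* (1975), Remark 9.23.
-/

set_option autoImplicit false

noncomputable section

open MeasureTheory Measure Set NumberField IsDedekindDomain
open Literature.MeasureTheory.Group
open scoped ENNReal NNReal

namespace Literature.NumberTheory.Rogawski1990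

open Literature.NumberTheory.Automorphic

section Covol

variable (L : Type) [Field L] [NumberField L] [IsCMField L] (H' : Matrix (Fin 3) (Fin 3) L)
  [MeasurableSpace (UnitaryGroup.cmDatum L 3 H').Adelic] [BorelSpace (UnitaryGroup.cmDatum L 3 H').Adelic]
  [∀ γ : (UnitaryGroup.cmDatum L 3 H').Adelic, MeasurableSpace (↥(Subgroup.centralizer ({γ} : Set (UnitaryGroup.cmDatum L 3 H').Adelic)) ⧸
    ((UnitaryGroup.cmDatum L 3 H').quotientSubgroup ⊓ Subgroup.centralizer ({γ} : Set (UnitaryGroup.cmDatum L 3 H').Adelic)).subgroupOf (Subgroup.centralizer ({γ} : Set (UnitaryGroup.cmDatum L 3 H').Adelic)))]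
  [∀ γ : (UnitaryGroup.cmDatum L 3 H').Adelic, BorelSpace (↥(Subgroup.centralizer ({γ} : Set (UnitaryGroup.cmDatum L 3 H').Adelic)) ⧸
    ((UnitaryGroup.cmDatum L 3 H').quotientSubgroup ⊓ Subgroup.centralizer ({γ} : Set (UnitaryGroup.cmDatum L 3 H').Adelic)).subgroupOf (Subgroup.centralizer ({γ} : Set (UnitaryGroup.cmDatum L 3 H').Adelic)))]
  [hCcl : ∀ γ : (UnitaryGroup.cmDatum L 3 H').Adelic, IsClosed ((Subgroup.centralizer ({γ} : Set (UnitaryGroup.cmDatum L 3 H').Adelic) : Subgroup (UnitaryGroup.cmDatum L 3 H').Adelic) : Set (UnitaryGroup.cmDatum L 3 H').Adelic)]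
  [∀ γ : (UnitaryGroup.cmDatum L 3 H').Adelic, (count : Measure ↥(((UnitaryGroup.cmDatum L 3 H').quotientSubgroup ⊓ Subgroup.centralizer ({γ} : Set (UnitaryGroup.cmDatum L 3 H').Adelic)).subgroupOf
    (Subgroup.centralizer ({γ} : Set (UnitaryGroup.cmDatum L 3 H').Adelic)))).IsHaarMeasure]

/-- **(γ2) THE COVOLUME PULL-OUT in (T′)'s tokens**: at a rational class `c`, for a Haar, right- and inversion-invariant measure `T` on `Z_c(𝔸)` and `k ≠ 0` in `ℝ≥0`,
`covol(Z_c(L⁺)∖Z_c(𝔸); k • T) = k • covol(Z_c(L⁺)∖Z_c(𝔸); T)` (★ `quotientMeasure_nnreal_smul_haar` with the counting measure on the COUNTABLE rational centraliser lattice,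
★ `countable_quotientSubgroup_inf_centralizer_subgroupOf`). [cite: Rogawski1990, §14.5 p. 239] [cite: DeitmarEchterhoff2014, Thm. 1.5.3] -/
theorem covol_nnreal_smul (c : ConjClasses (UnitaryGroup.cmDatum L 3 H').Rational)
    (T : Measure (Subgroup.centralizer ({((UnitaryGroup.cmDatum L 3 H').toAdelic (Quotient.out c))} : Set (UnitaryGroup.cmDatum L 3 H').Adelic)))
    [T.IsHaarMeasure] [T.IsMulRightInvariant] [T.IsInvInvariant] (k : ℝ≥0) (hk : k ≠ 0) :
    haveI := IsHaarMeasure.nnreal_smul T hk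
    quotientMeasure (((UnitaryGroup.cmDatum L 3 H').quotientSubgroup ⊓
        Subgroup.centralizer ({(UnitaryGroup.cmDatum L 3 H').toAdelic (Quotient.out c)} : Set (UnitaryGroup.cmDatum L 3 H').Adelic)).subgroupOf
        (Subgroup.centralizer ({(UnitaryGroup.cmDatum L 3 H').toAdelic (Quotient.out c)} : Set (UnitaryGroup.cmDatum L 3 H').Adelic))) count
        (isClosed_subgroupOf _ _ ((UnitaryGroup.isClosed_cmDatum_quotientSubgroup L 3 H').inter (hCcl _))) (k • T) Set.univ =
      k • quotientMeasure (((UnitaryGroup.cmDatum L 3 H').quotientSubgroup ⊓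
        Subgroup.centralizer ({(UnitaryGroup.cmDatum L 3 H').toAdelic (Quotient.out c)} : Set (UnitaryGroup.cmDatum L 3 H').Adelic)).subgroupOf
        (Subgroup.centralizer ({(UnitaryGroup.cmDatum L 3 H').toAdelic (Quotient.out c)} : Set (UnitaryGroup.cmDatum L 3 H').Adelic))) count
        (isClosed_subgroupOf _ _ ((UnitaryGroup.isClosed_cmDatum_quotientSubgroup L 3 H').inter (hCcl _))) T Set.univ := by
  haveI := UnitaryGroup.countable_quotientSubgroup_inf_centralizer_subgroupOf L 3 H' ((UnitaryGroup.cmDatum L 3 H').toAdelic (Quotient.out c))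
  haveI : LocallyCompactSpace (Subgroup.centralizer ({((UnitaryGroup.cmDatum L 3 H').toAdelic (Quotient.out c))} : Set (UnitaryGroup.cmDatum L 3 H').Adelic)) :=
    (hCcl _).isClosedEmbedding_subtypeVal.locallyCompactSpace
  rw [quotientMeasure_nnreal_smul_haar (hZ := isClosed_subgroupOf _ _ ((UnitaryGroup.isClosed_cmDatum_quotientSubgroup L 3 H').inter (hCcl _)))
      (((UnitaryGroup.cmDatum L 3 H').quotientSubgroup ⊓ Subgroup.centralizer ({(UnitaryGroup.cmDatum L 3 H').toAdelic (Quotient.out c)} : Set (UnitaryGroup.cmDatum L 3 H').Adelic)).subgroupOf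
        (Subgroup.centralizer ({(UnitaryGroup.cmDatum L 3 H').toAdelic (Quotient.out c)} : Set (UnitaryGroup.cmDatum L 3 H').Adelic))) count T k hk,
    Measure.smul_apply]

end Covol

end Literature.NumberTheory.Rogawski1990

end
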